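import Mathlib
import HarnessLib
import Literature.Computability.QuantumComplexity.StabilizerRank

/-!
# Mehraban–Tahmasbi 2024, Theorem 3.1: the quadratic lower bound for `χ_δ(|T⟩^{⊗m})`

Topic `Literature/Computability/QuantumComplexity`; ONE named fact (result in print, `def … : Prop`,
D-0014): the current RECORD lower bound on the approximate stabilizer rank of magic-state powers,
requested by the grounding of route `QuantumAdvantage/FermionicMagic` (whose Assembly targets the
superpolynomial version, item `stmt-QuantumAdvantage-0247` of route `Dequantize`) as the benchmark
every item of that route must beat. Companion of the sibling file
`ApproxStabilizerRankTransfer.lean` (p40030, g12-5: Lemma 3.6 gadget transfer, Lemma 3.2 existence of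
high-rank states, §3.4(a) ancilla removal), deliberately not duplicated here.

S. Mehraban, M. Tahmasbi, *Quadratic lower bounds on the approximate stabilizer rank: a
probabilistic approach*, STOC 2024 = arXiv:2305.10277 (held text read, p. 12 and §3.4 pp. 14–15):

> **Theorem 3.1.** Let `1 > δ > 0`. We have `χ_δ(|T⟩^{⊗m}) = Ω((1−δ²)² m² / polylog(m))`.

(Thm 1.1 is its informal statement; the proof in §3.4 ends with `Ω((1−δ²)² m² / log⁴ m)`.)
Superpolynomial lower bounds are OPEN; known conditionally only (Thm 1.6: the EXACT rank of
`|T⟩^{⊗m}` is superpolynomial unless the permanent has polynomial-size circuits; Thm 1.11 for the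
approximate rank under a PH-type assumption); Conj. 1.3 of the paper asks for explicit low-`T`-count
high-rank states — the programme of route `FermionicMagic`.

## Rendering

Over the tree's `approxStabilizerRank δ ψ` and `tensorPow magicT m = |T⟩^{⊗m}`
(`StabilizerRank.lean`). The `Ω` is rendered conservatively: for each `δ ∈ (0,1)` there are
`c > 0`, an exponent `A : ℕ` and `m₀` with `c · m² / (log m)^A ≤ χ_δ(|T⟩^{⊗m})` for all `m ≥ m₀`
(weaker than print, which has `A = 4` and `c ∝ (1−δ²)²` with an absolute constant).

## References

* [MehrabanTahmasbi2024] arXiv:2305.10277: Thm 1.1 (p. 3), Thm 3.1 and Lemma 3.2 (p. 12),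
  Lemmas 3.6–3.8 (pp. 13–14), §3.4 (pp. 14–15), Thm 1.6, Thm 1.11, Conj. 1.3.
* Peleg–Shpilka–Volk 2022 (arXiv:2106.03214): the previous (linear / `√`) bounds.
-/

noncomputable section

namespace Literature.Computability.QuantumComplexity

/-- **Mehraban–Tahmasbi 2024, Theorem 3.1** (= Thm 1.1; the record lower bound for magic states):
for `0 < δ < 1`, `χ_δ(|T⟩^{⊗m}) = Ω((1−δ²)² m² / polylog m)`. Rendered conservatively: for every
such `δ` there are `c > 0`, an exponent `A` and `m₀` with `c · m² / (log m)^A ≤ χ_δ(|T⟩^{⊗m})` for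
all `m ≥ m₀` (the paper's proof gives `A = 4` and `c ∝ (1−δ²)²`). Superpolynomial lower bounds are
open (known only conditionally: Thm 1.6, exact rank, unless the permanent has polynomial-size
circuits; Thm 1.11 for the approximate rank). [cite: MehrabanTahmasbi2024, Thm 3.1 (arXiv p. 12)] -/
def MehrabanTahmasbi2024_approxRank_magicT_quadratic : Prop :=
  ∀ δ : ℝ, 0 < δ → δ < 1 → ∃ c : ℝ, 0 < c ∧ ∃ A m₀ : ℕ, ∀ m : ℕ, m₀ ≤ m →
    c * (m : ℝ) ^ 2 / Real.log m ^ A ≤ (approxStabilizerRank δ (tensorPow magicT m) : ℝ)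

end Literature.Computability.QuantumComplexity

end
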